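import Mathlib
import Literature.NumberTheory.Transcendental.ErdosConjectureDivisorBoundProofs
import HarnessLib

/-!
# Erdős's conjecture `Σ f(n)/n ≠ 0` for every modulus `q < 105` (the settled criteria, collected)

Topic `Literature/NumberTheory/Transcendental`; namespace `Literature.NumberTheory.Transcendental.OkadaCriterion`.
THEOREMS only (no definition, no named fact, no `sorry`, kernel `decide` on bounded arithmetic only); cell pub-zeta5,
P1 g58. A bookkeeping leaf over `ErdosConjectureOkadaProofs.lean` (Okada's `2φ(q)+1 > q`, prime powers, two odd
primes) and P1 g57's `ErdosConjectureThreeModFour.lean` (Murty–Saradha 2010, Theorem 7; even and prime moduli):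
T. Chatterjee, M. Ram Murty, PJM **275** (2015) [ChatterjeeMurty2015], §1: «In 1982, Okada established the conjecture
if `2φ(q)+1 > q`. … the conjecture holds for even `q`. … In 2010, they proved that the Erdős conjecture is true if
`q ≡ 3 (mod 4)` … Thus the conjecture is open only in cases where `q ≡ 1 (mod 4)`»; R. Tijdeman (2002)
[Tijdeman2002], Appendix.

## What is proved

* `prime_or_mod_four_ne_one_or_lt_of_lt_105` — every `2 ≤ N < 105` is prime, or `≢ 1 (mod 4)`, or has
  `N < 2φ(N) + 1` (kernel `decide`; the bound `105` is where the default recursion depth of `decide` on `Nat.totient`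
  ends and, at the same time, the first modulus the criteria miss);
* **`erdos_conjecture_of_lt_105`** — hence Erdős's conjecture (series form, no convergence hypothesis) for every
  modulus `2 ≤ q < 105`;
* `criteria_at_105` — at `q = 105 = 3·5·7` NONE of the sufficient conditions in the tree applies: `105` is
  composite, `≡ 1 (mod 4)`, `2φ(105) + 1 = 97 ≤ 105`, `d(105) = 8 > 3 = minFac` (and, in words,
  `Σ_{d∣105, 1<d<105} 1/φ(d) = 7/6 ≥ 1`, so Chatterjee–Murty's Proposition 3.1 yields no contradiction either).
  This documents the FIRST modulus left open by the printed criteria; it is NOT a statement about Erdős's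
  conjecture at `105`, which stays OPEN.

HONEST FRAMING: finite bookkeeping over printed criteria; nothing here concerns `ζ(5)`.
-/

noncomputable section

open Complex Finset Filter Topology

namespace Literature.NumberTheory.Transcendental

namespace OkadaCriterion

/-- The settled criteria cover every modulus `2 ≤ N < 105`: each such `N` is prime, or even, or `≡ 3 (mod 4)`, or
has `2φ(N) + 1 > N` (kernel `decide`). [cite: ChatterjeeMurty2015, §1] -/
theorem prime_or_mod_four_ne_one_or_lt_of_lt_105 :
    ∀ N : ℕ, 2 ≤ N → N < 105 → N.Prime ∨ N % 4 ≠ 1 ∨ N < 2 * N.totient + 1 := by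
  decide

/-- **Erdős's conjecture for every modulus `2 ≤ q < 105`**: for such `N` and `f : ℤ/N → ℂ` with `f(0) = 0`,
`f(b) = ±1` (`b ≠ 0`), the partial sums `Σ_{n≤M} f(n)/n` do not tend to `0` (Baker–Birch–Wirsing / parity /
Murty–Saradha Thm 7 / Okada's `2φ(q)+1 > q`, whichever applies; `q = 105` is the first modulus none of them covers,
`criteria_at_105`). [cite: ChatterjeeMurty2015, §1] [cite: Okada1982, Corollary] [cite: Tijdeman2002, Appendix] -/
theorem erdos_conjecture_of_lt_105 {N : ℕ} [NeZero N] (hN2 : 2 ≤ N) (hN : N < 105)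
    (Φ : ZMod N → ℂ) (h0 : Φ 0 = 0) (hpm : ∀ b : ZMod N, b ≠ 0 → Φ b = 1 ∨ Φ b = -1) :
    ¬ Tendsto (fun M : ℕ => ∑ n ∈ range M, Φ ((n + 1 : ℕ) : ZMod N) / ((n + 1 : ℕ) : ℂ))
      atTop (𝓝 0) :=
  erdos_conjecture_of_prime_or_mod_four_ne_one_or_lt hN2 (prime_or_mod_four_ne_one_or_lt_of_lt_105 N hN2 hN)
    Φ h0 hpm

/-- **`q = 105` is the first modulus not covered by the criteria in the tree**: `105 = 3·5·7` is composite,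
`105 ≡ 1 (mod 4)`, `2φ(105) + 1 = 97 ≤ 105` (Okada's bound fails), `#divisors(105) = 8 > 3 = minFac 105`
(Chatterjee–Murty Cor. 3.3 fails); moreover `Σ_{d∣105, 1<d<105} 1/φ(d) = 1/2 + 1/4 + 1/6 + 1/8 + 1/12 + 1/24 = 7/6 ≥ 1`,
so their Prop. 3.1 yields no contradiction either (arithmetic, stated in words). NOT a statement about Erdős's
conjecture at `105`, which remains OPEN. [cite: ChatterjeeMurty2015, §1 and §3] -/
theorem criteria_at_105 :
    ¬ Nat.Prime 105 ∧ 105 % 4 = 1 ∧ 2 * Nat.totient 105 + 1 = 97 ∧ (Nat.divisors 105).card = 8 ∧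
      Nat.minFac 105 = 3 := by
  refine ⟨by norm_num, by decide, by decide, by decide, by norm_num⟩

end OkadaCriterion

end Literature.NumberTheory.Transcendental

end
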